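import Mathlib
import HarnessLib
import Summits.HubbardSuperconductivity.HubbardSuperconductivity.Theorems.KLProgrammeKLRegimeAlphaFatClosedShiftRows
import Summits.HubbardSuperconductivity.HubbardSuperconductivity.Theorems.KLProgrammeKLRegimeSectorSliceGramRegime
import Summits.HubbardSuperconductivity.HubbardSuperconductivity.Theorems.KLProgrammeKLRegimeFrameOKDerivBounds
import Summits.HubbardSuperconductivity.HubbardSuperconductivity.Theorems.KLProgrammeSalmhoferCutoffDerivBound
import Summits.HubbardSuperconductivity.HubbardSuperconductivity.Theorems.KLProgrammeSalmhoferCutoffSecondDerivBound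

/-!
# Route `KLProgramme` — ENGINE child stmt-HubbardSuperconductivity-20236 `KLRegimeEngineV16`, `stub_engine_step_norms`: **`α` IN THE KL REGIME** — the
# row and column sums `hrow`/`hcol` of `S(Ft_n)ᵀ · klSliceCov (n+j) · S(Ft_n)` (fat family of index `n`, engine slice `j` scales deeper) are
# `≤ Cα_j·(M/β)/Λ_{n+j}`, ONE absolute constant per shift `j`, keyed by `FrameOK` / under EXACTLY the gen-6 stub binders

Cell gate-hubbard-kl, seat hubbard-kl-k3c2-p3 (g4, row «sector-counting import (DR2000 L11/L12) for the leg-dress bar»).  The engine instance of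
`rowSum_/colSum_sliceCT_bgmFat_closed_shift` (…AlphaFatClosedShiftRows; g2's closed form p493799 at a shifted slice): frame data from
`FrameOK R U (nScales β) μ K` in the regime (p4's thresholds `κ₀ = min (min (Dt_min/4) (ρ_min/4)) (1/40)` of `B = bandBounds (−6/5) (−1/10)`,
frame `C²` size `A := κ₀/4`, `K₁ = K₂ = 7` by …FrameOKDerivBounds, cutoff data `B₁ = 32/3`, `B₂ = 448e²/3`, profile/angle constants of
`exists_abs_derivs_bgmCutoffSq_le` / `exists_norm_iteratedDeriv_sectorWeightCirc_polarAngle_line_le 2`), scale thresholds from `n + j ≤ nScales β + 1`, `β² ≤ L`,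
`β ≤ M` (`regime_scale_thresholds`, `R₀ := (L−1)/(2(2^{n+1}+1))`, `δ_L := 1/2`), shift `r = 4^j`:

* **`alpha_klSliceCov_bgmFat_of_thresholds (ha hab hb) (j)`** — `∃ Cα > 0`: for every `R` (`Gfr ≥ 0`), `0 < c ≤ κ₀/(12(Gfr₂+1))`,
  `0 < U ≤ min 1 (κ₀/(24(Gfr₀+Gfr₁+1)))`, `klBetaMin ≤ β ≤ e^{c/U²}`, `μ ∈ klWindowC`, `FrameOK R U (nScales β) μ K`, `β² ≤ L`, `β ≤ M`, `1 ≤ n`,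
  `n + j ≤ nScales β + 1`: every row sum and every column sum of `‖S(Ft_n)ᵀ·klSliceCov (n+j)·S(Ft_n)‖` is `≤ Cα·(M/β)/klScale klE0 (n+j)`
  (so `ε_x·α = O(1/Λ_{n+j})`, BGM (2.81), n-, β-, L-, M-, frame-uniform);
* **`alpha_klSliceCov_bgmFat_klEng (j)`** — the same under EXACTLY the stub binders (`P.WF`, `R.WF2`, `c ≤ klEngC₃3 P R`, `U ≤ klEngU₀4 P R c`,
  `klEngL₃ β U ≤ L`, `klEngM₃ β U L ≤ M`).  r2d-p2's norms-step door (pairing fat(n−1), `klSliceCov (n+1)`) reads `j = 2` with `n ↦ n−1`.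

Everything is proved; no definitions, no named facts. [cite: BenfattoGiulianiMastropietro2006, §2.8 (2.81)]
-/

noncomputable section

namespace Summit.HubbardSuperconductivity.HubbardSuperconductivity.Theorems.TorusFourierL2

set_option linter.dupNamespace false -- summit = problem name (single-conjunct summit), D-0017

open Set Finset Literature.MathematicalPhysics.QuantumLattice Literature.MathematicalPhysics.QuantumLattice.BandSectorCounting
open Literature.MathematicalPhysics.QuantumLattice.FermiRG Literature.Probability.LatticeModels Literature.Analysis.SpecialFunctions
open Summit.HubbardSuperconductivity.HubbardSuperconductivity.Theorems.DispersionFlow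
open Summit.HubbardSuperconductivity.HubbardSuperconductivity.Theorems.KLRegimeSplit
open Summit.HubbardSuperconductivity.HubbardSuperconductivity.Theorems.KLProgrammeLegKernels
open Summit.HubbardSuperconductivity.HubbardSuperconductivity.Theorems.PerturbedFermiCurve
open Summit.HubbardSuperconductivity.HubbardSuperconductivity.Theorems.KLRegimeWick
open scoped Real Nat

set_option maxHeartbeats 1600000 in
/-- **`α` of the fat-sectorised engine slice `j` scales below the family, in the KL regime, absolute thresholds exposed.**
[cite: BenfattoGiulianiMastropietro2006, §2.8 (2.81)] -/
theorem alpha_klSliceCov_bgmFat_of_thresholds (ha : (-4 : ℝ) < -(6 / 5)) (hab : (-(6 / 5) : ℝ) ≤ -(1 / 10)) (hb : (-(1 / 10) : ℝ) < 0) (j : ℕ) :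
    ∃ Cα : ℝ, 0 < Cα ∧ ∀ (R : RenConsts), (∀ i, 0 ≤ R.Gfr i) →
      ∀ (c U : ℝ), 0 < c →
      c ≤ min (min ((bandBounds ha hab hb).Dtmin / 4) ((bandBounds ha hab hb).rhomin / 4)) (1 / 40) / (12 * (R.Gfr 2 + 1)) → 0 < U →
      U ≤ min 1 (min (min ((bandBounds ha hab hb).Dtmin / 4) ((bandBounds ha hab hb).rhomin / 4)) (1 / 40) / (24 * (R.Gfr 0 + R.Gfr 1 + 1))) →
      ∀ β : ℝ, klBetaMin ≤ β → β ≤ Real.exp (c / U ^ 2) → ∀ μ ∈ klWindowC, ∀ K : TrigPolyC4v, FrameOK R U (nScales β) μ K →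
      ∀ (L M : ℕ) [NeZero L] [NeZero M], β ^ 2 ≤ (L : ℝ) → β ≤ (M : ℝ) → ∀ n : ℕ, 1 ≤ n → n + j ≤ nScales β + 1 →
        (∀ Y : SpaceTimeIdx L M × SectorLeg (sectorCount n),
          ∑ Y', ‖((sectorSubMatrix L M β (bgmFatMultiplier L M klE0 β (nambuXiCT L μ K) n)).transpose * klSliceCov L M β μ K (n + j) *
            sectorSubMatrix L M β (bgmFatMultiplier L M klE0 β (nambuXiCT L μ K) n)) Y Y'‖ ≤ Cα * ((M : ℝ) / β) / klScale klE0 (n + j)) ∧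
        (∀ Y' : SpaceTimeIdx L M × SectorLeg (sectorCount n),
          ∑ Y, ‖((sectorSubMatrix L M β (bgmFatMultiplier L M klE0 β (nambuXiCT L μ K) n)).transpose * klSliceCov L M β μ K (n + j) *
            sectorSubMatrix L M β (bgmFatMultiplier L M klE0 β (nambuXiCT L μ K) n)) Y Y'‖ ≤ Cα * ((M : ℝ) / β) / klScale klE0 (n + j)) := by
  -- the window band bounds and the absolute frame-size threshold (as in p4's `overlap_sums_klAniso_bgmFat_of_thresholds`)
  set B : BandBounds (-(6 / 5)) (-(1 / 10)) := bandBounds ha hab hb with hBdef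
  set κ₀ : ℝ := min (min (B.Dtmin / 4) (B.rhomin / 4)) (1 / 40) with hκ₀
  have hDt := B.Dtmin_pos
  have hrh := B.rhomin_pos
  have hκ₀pos : 0 < κ₀ := by rw [hκ₀]; exact lt_min (lt_min (by positivity) (by positivity)) (by norm_num)
  have hκ₀Dt : κ₀ ≤ B.Dtmin / 4 := (min_le_left _ _).trans (min_le_left _ _)
  have hκ₀rh : κ₀ ≤ B.rhomin / 4 := (min_le_left _ _).trans (min_le_right _ _)
  have hκ₀40 : κ₀ ≤ 1 / 40 := min_le_right _ _
  have hrh2 : B.rhomin ≤ 2 := by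
    have : B.rhomin = cRhomin (-(6 / 5)) (-(1 / 10)) := rfl
    rw [this]; exact cRhomin_le_two (by norm_num) (by norm_num)
  -- the cutoff-profile and angular constants
  have he : (0 : ℝ) < klE0 := by norm_num [klE0]
  obtain ⟨d₀, hd₀, hd₀1, hd₀2⟩ := exists_abs_derivs_bgmCutoffSq_le he
  obtain ⟨B₀, hB₀0, hB₀⟩ := exists_norm_iteratedDeriv_sectorWeightCirc_polarAngle_line_le 2
  -- the absolute constants
  set A : ℝ := κ₀ / 4 with hAdef
  have hA0 : 0 < A := by rw [hAdef]; positivity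
  have hDtA : 0 < B.Dtmin - 2 * A := by rw [hAdef]; linarith
  have hγ : 0 < 2 * B.rhomin - 4 * A := by rw [hAdef]; linarith
  have hγ4 : 2 * B.rhomin - 4 * A ≤ 4 := by linarith
  have hsm := B.smax_pos
  have hπ := Real.pi_pos
  have hπ3 := Real.pi_gt_three
  set r : ℝ := (4 : ℝ) ^ j with hrdef
  have hr1 : 1 ≤ r := one_le_pow₀ (by norm_num)
  have hr0 : 0 < r := by positivity
  obtain ⟨cρ, hcρ⟩ : ∃ cρ : ℝ, cρ = (2 * klE0 / π + B.smax * B.Dtmin * (3 / 4)) / (B.Dtmin - 2 * A) +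
      π * Real.sqrt 2 * (1 + (4 + 2 * A) / (B.Dtmin - 2 * A)) := ⟨_, rfl⟩
  obtain ⟨G₁, hG₁⟩ : ∃ G₁ : ℝ, G₁ = d₀ * klE0 ^ 2 * 1 + 1 * (d₀ * klE0 ^ 2) := ⟨_, rfl⟩
  obtain ⟨G₂, hG₂⟩ : ∃ G₂ : ℝ, G₂ = d₀ * klE0 ^ 4 * 1 + 2 * (d₀ * klE0 ^ 2) * (d₀ * klE0 ^ 2) + 1 * (d₀ * klE0 ^ 4) := ⟨_, rfl⟩
  obtain ⟨Kp, hKp⟩ : ∃ Kp : ℝ, Kp = 4 + 4 * A := ⟨_, rfl⟩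
  obtain ⟨b₁, hb₁⟩ : ∃ b₁ : ℝ, b₁ = 4 + 2 * A + Kp * (cρ * π + 2) := ⟨_, rfl⟩
  obtain ⟨bτ, hbτ⟩ : ∃ bτ : ℝ, bτ = 4 + 2 * A + 2 * (7 : ℝ) * (cρ * π) := ⟨_, rfl⟩
  obtain ⟨ae1, hae1⟩ : ∃ ae1 : ℝ, ae1 = G₁ * (4 + 2 * A + Kp * (cρ * π + 2)) / 2 + 72 * B₀ * klE0 := ⟨_, rfl⟩
  obtain ⟨ae2, hae2⟩ : ∃ ae2 : ℝ, ae2 = (4 * G₂ + 2 * G₁) * (4 + 2 * A + Kp * (cρ * π + 2)) ^ 2 / 16 + G₁ * Kp * klE0 / 2 +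
      144 * G₁ * (4 + 2 * A + Kp * (cρ * π + 2)) * B₀ * klE0 + 36 * (4 * B₀ + 8 * B₀ ^ 2) * klE0 ^ 2 := ⟨_, rfl⟩
  obtain ⟨qe, hqe⟩ : ∃ qe : ℝ, qe = (32 * (448 / 3 * Real.exp 2) + 144 * (32 / 3 : ℝ) + 128) * (Real.sqrt 2 * 7 + 8 * 7) ^ 2 / 4 +
      (16 * (32 / 3 : ℝ) + 16) * 7 * klE0 / 2 + ae1 * (16 * (32 / 3 : ℝ) + 16) * (Real.sqrt 2 * 7 + 6 * 7) / 2 + ae2 := ⟨_, rfl⟩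
  obtain ⟨av1, hav1⟩ : ∃ av1 : ℝ, av1 = G₁ * (4 + 2 * A + Kp * (cρ * π + 2)) / (2 * klE0) + 288 * B₀ := ⟨_, rfl⟩
  obtain ⟨av2, hav2⟩ : ∃ av2 : ℝ, av2 = (4 * G₂ + 2 * G₁) * (4 + 2 * A + Kp * (cρ * π + 2)) ^ 2 / (16 * klE0 ^ 2) + G₁ * Kp / (2 * klE0) +
      144 * G₁ * (4 + 2 * A + Kp * (cρ * π + 2)) * B₀ / klE0 + 144 * (4 * B₀ + 8 * B₀ ^ 2) := ⟨_, rfl⟩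
  obtain ⟨qv, hqv⟩ : ∃ qv : ℝ, qv = (32 * (448 / 3 * Real.exp 2) + 144 * (32 / 3 : ℝ) + 128) * (bτ + 8 * 7) ^ 2 / (4 * (klE0 / r) ^ 2) +
      (16 * (32 / 3 : ℝ) + 16) * 7 / (2 * (klE0 / r)) + av1 * (16 * (32 / 3 : ℝ) + 16) * (bτ + 6 * 7) / (2 * (klE0 / r)) + av2 := ⟨_, rfl⟩
  obtain ⟨Dt, hDt'⟩ : ∃ Dt : ℝ, Dt = (32 * (448 / 3 * Real.exp 2) + 144 * (32 / 3 : ℝ) + 128) + G₁ * (16 * (32 / 3 : ℝ) + 16) + G₂ + G₁ / 2 :=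
    ⟨_, rfl⟩
  obtain ⟨x₀, hx₀⟩ : ∃ x₀ : ℝ, x₀ = π / 2 * Real.sqrt Dt := ⟨_, rfl⟩
  obtain ⟨x₁, hx₁⟩ : ∃ x₁ : ℝ, x₁ = π / 2 * Real.sqrt qe := ⟨_, rfl⟩
  obtain ⟨x₂, hx₂⟩ : ∃ x₂ : ℝ, x₂ = 5 * π / 4 * Real.sqrt qe := ⟨_, rfl⟩
  obtain ⟨x₃, hx₃⟩ : ∃ x₃ : ℝ, x₃ = 5 * π / 4 * Real.sqrt qv := ⟨_, rfl⟩
  obtain ⟨c₁, hc₁⟩ : ∃ c₁ : ℝ, c₁ = 4 + Kp * cρ ^ 2 * π ^ 2 / klE0 := ⟨_, rfl⟩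
  obtain ⟨CW, hCW⟩ : ∃ CW : ℝ, CW = 4096 * x₀ * (4 * ((2 * Real.sqrt 2 * x₂ + 2) * (2 * Real.sqrt 2 * x₃ + 1)) +
      160 * x₁ * (x₁ + 1) ^ 2 / (1 / 2 : ℝ)) := ⟨_, rfl⟩
  obtain ⟨CN, hCN⟩ : ∃ CN : ℝ, CN = 128 * c₁ * cρ / (π ^ 2 * (2 * B.rhomin - 4 * A)) * r ^ 2 := ⟨_, rfl⟩
  have hcρ0 : 0 < cρ := by rw [hcρ]; positivity
  have hKp0 : 0 < Kp := by rw [hKp]; positivity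
  have hG₁0 : 0 ≤ G₁ := by rw [hG₁]; positivity
  have hG₂0 : 0 ≤ G₂ := by rw [hG₂]; positivity
  have hDtpos : 0 < Dt := by rw [hDt']; positivity
  have hae10 : 0 ≤ ae1 := by rw [hae1]; positivity
  have hae20 : 0 ≤ ae2 := by rw [hae2]; positivity
  have hqe0 : 0 < qe := by rw [hqe]; positivity
  have hbτ0 : 0 < bτ := by rw [hbτ]; positivity
  have hav10 : 0 ≤ av1 := by rw [hav1]; positivity
  have hav20 : 0 ≤ av2 := by rw [hav2]; positivity
  have hqv0 : 0 < qv := by rw [hqv]; positivity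
  have hx₀0 : 0 < x₀ := by rw [hx₀]; positivity
  have hx₁0 : 0 < x₁ := by rw [hx₁]; positivity
  have hx₂0 : 0 < x₂ := by rw [hx₂]; positivity
  have hx₃0 : 0 < x₃ := by rw [hx₃]; positivity
  have hc₁0 : 0 < c₁ := by rw [hc₁]; positivity
  have hCW0 : 0 < CW := by rw [hCW]; positivity
  have hCN0 : 0 < CN := by rw [hCN]; positivity
  refine ⟨8 * ((9 : ℕ) * (4 * Real.sqrt (32 * CW * CN))), by positivity, ?_⟩
  intro R hR c U hc hcle hU hUle β hβmin hβc μ hμ K hK L M _ _ hLβ hMβ n hn hnN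
  have hβ0 : 0 < β := pos_of_klBetaMin_le hβmin
  have hβ128 : 128 ≤ β := by simpa [klBetaMin] using hβmin
  have hL0 : (0 : ℝ) < L := lt_of_lt_of_le (by positivity) hLβ
  have hM0 : (0 : ℝ) < M := lt_of_lt_of_le hβ0 hMβ
  -- the frame's `C²` size is `≤ A = κ₀/4`
  have hlog : 1 ≤ Real.log 4 := by
    have h4 : Real.exp 1 ≤ 4 := by have := Real.exp_one_lt_d9; norm_num at this; linarith
    calc (1 : ℝ) = Real.log (Real.exp 1) := (Real.log_exp 1).symm
      _ ≤ Real.log 4 := Real.log_le_log (Real.exp_pos 1) h4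
  have hAK : ∀ p : Momentum, ∀ i ≤ 2, ‖iteratedFDeriv ℝ i (frameShift K) p‖ ≤ A := by
    intro p i hi
    refine (norm_iteratedFDeriv_frameShift_le_of_frameOK_regime hR hc.le hβmin hβc hK p hi).trans ?_
    have h0 := hR 0; have h1 := hR 1; have h2 := hR 2
    have hU1 : U ≤ 1 := hUle.trans (min_le_left _ _)
    have hUk : U ≤ κ₀ / (24 * (R.Gfr 0 + R.Gfr 1 + 1)) := hUle.trans (min_le_right _ _)
    rw [abs_of_pos hU]
    have hU2 : U ^ 2 ≤ U := by nlinarith only [hU, hU1]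
    have hA1 : 2 * R.Gfr 0 * U + 2 * R.Gfr 1 * U ^ 2 ≤ 2 * (R.Gfr 0 + R.Gfr 1 + 1) * U := by
      have := mul_le_mul_of_nonneg_left hU2 h1
      linarith only [this, hU.le]
    have hB1 : 2 * (R.Gfr 0 + R.Gfr 1 + 1) * U ≤ κ₀ / 12 := by
      have hpos : 0 < 24 * (R.Gfr 0 + R.Gfr 1 + 1) := by positivity
      have := (le_div_iff₀ hpos).mp hUk
      linarith only [this]
    have hC1 : R.Gfr 2 * (c / Real.log 4) ≤ R.Gfr 2 * c := mul_le_mul_of_nonneg_left (div_le_self hc.le hlog) h2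
    have hD1 : R.Gfr 2 * c ≤ κ₀ / 12 := by
      have hpos : 0 < 12 * (R.Gfr 2 + 1) := by positivity
      have := (le_div_iff₀ hpos).mp hcle
      linarith only [this, hc.le]
    rw [hAdef]; linarith only [hA1, hB1, hC1, hD1, hκ₀pos]
  -- the window margins
  have hμ' := hμ
  simp only [klWindowC, Set.mem_Icc] at hμ'
  have e1 : (-1.05 : ℝ) = -(21 / 20) := by norm_num
  have e2 : (-0.15 : ℝ) = -(3 / 20) := by norm_num
  have hμlo : -(21 / 20 : ℝ) ≤ μ := by rw [← e1]; exact hμ'.1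
  have hμhi : μ ≤ -(3 / 20 : ℝ) := by rw [← e2]; exact hμ'.2
  have he0 : klE0 = 1 / 32 := rfl
  have hgap : klE0 + A + (1 / 10 : ℝ) ^ 2 < -μ := by rw [he0, hAdef]; linarith only [hμhi, hκ₀40]
  have h3 : klE0 + A - μ ≤ 3 := by rw [he0, hAdef]; linarith only [hμlo, hκ₀40]
  have hlo : (-(6 / 5) : ℝ) ≤ μ - A - klE0 := by rw [he0, hAdef]; linarith only [hμlo, hκ₀40]
  have hhi : μ + A + klE0 ≤ -(1 / 10) := by rw [he0, hAdef]; linarith only [hμhi, hκ₀40]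
  have hADt : 2 * A < B.Dtmin := by rw [hAdef]; linarith
  have hρA : 4 * A < 2 * B.rhomin := by rw [hAdef]; linarith
  -- frame band and cutoff data
  have hK₁ : ∀ p : Momentum, ‖fderiv ℝ (frameLevel μ K) p‖ ≤ 7 := fun p => norm_fderiv_frameLevel_le_of_frameOK hK p
  have hK₂ : ∀ p : Momentum, ‖iteratedFDeriv ℝ 2 (frameLevel μ K) p‖ ≤ 7 := fun p => norm_iteratedFDeriv_two_frameLevel_le_of_frameOK hK p
  have hB₁ : ∀ x, |deriv salmhoferCutoff x| ≤ 32 / 3 := klcd_abs_deriv_salmhoferCutoff_le_sharp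
  have hB₂ : ∀ x, |deriv (deriv salmhoferCutoff) x| ≤ 448 / 3 * Real.exp 2 := klsd_abs_deriv2_salmhoferCutoff_le
  -- the indices: `n = m + 1`, slice `(Λ_{m+1+j}, Λ_{m+j}]`
  obtain ⟨m, rfl⟩ : ∃ m, n = m + 1 := ⟨n - 1, by omega⟩
  have hmN : m ≤ nScales β := by omega
  have hanti : ∀ {a b : ℕ}, a ≤ b → klScale klE0 b ≤ klScale klE0 a := fun hab' => by
    unfold klScale; exact mul_le_mul_of_nonneg_left (inv_anti₀ (by positivity) (pow_le_pow_right₀ (by norm_num) hab')) he.le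
  have hslice : klSliceCov L M β μ K (m + 1 + j) = hubbardCovSliceCT L M β μ 0 K (klScale klE0 (m + 1 + j)) (klScale klE0 (m + j)) := by
    rw [klSliceCov, show m + 1 + j - 1 = m + j by omega]
  have hΛs : 0 < klScale klE0 (m + 1 + j) := klth_klScale_pos _
  have hΛsr : klScale klE0 (m + 1) = r * klScale klE0 (m + 1 + j) := by
    rw [hrdef, klScale, klScale, pow_add]; field_simp; ring
  have hΛΛ' : klScale klE0 (m + 1 + j) ≤ klScale klE0 (m + j) := hanti (by omega)
  -- scale thresholds
  obtain ⟨hMn, -, hLz, hL16, hΛβn⟩ := regime_scale_thresholds hβmin hLβ hMβ (show m + 1 ≤ nScales β + 1 by omega)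
  obtain ⟨-, -, -, -, hΛβs⟩ := regime_scale_thresholds hβmin hLβ hMβ hnN
  have hΛe : ∀ k, klScale klE0 k ≤ klE0 := fun k => klScale_le_e0 he.le k
  have h2M : β / 32 < π * (2 * (M : ℝ) - 3) := by
    have h1 : 3 * (2 * (M : ℝ) - 3) ≤ π * (2 * (M : ℝ) - 3) := mul_le_mul_of_nonneg_right hπ3.le (by linarith only [hMβ, hβ128])
    linarith only [h1, hMβ, hβ128]
  have heβ : klE0 * β = β / 32 := by rw [he0]; ring
  have hMm : klScale klE0 m * β < π * (2 * M - 3) := by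
    have h1 : klScale klE0 m * β ≤ klE0 * β := mul_le_mul_of_nonneg_right (hΛe m) hβ0.le
    linarith only [h1, h2M, heβ]
  have hM' : klScale klE0 (m + j) < π * (2 * M - 3) / β := by
    rw [lt_div_iff₀ hβ0]
    have h1 : klScale klE0 (m + j) * β ≤ klE0 * β := mul_le_mul_of_nonneg_right (hΛe (m + j)) hβ0.le
    linarith only [h1, h2M, heβ]
  have hπβ : π ≤ klScale klE0 m * β := by
    have := mul_le_mul_of_nonneg_right ((klth_pi_div_le_klScale_nScales hβmin).trans (hanti hmN)) hβ0.le
    rwa [div_mul_cancel₀ _ hβ0.ne'] at this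
  have h4pow : (2 : ℝ) ^ (m + 1) * ((2 : ℝ) ^ (m + 1) + 1 / 2) ≤ (16 : ℝ) ^ (m + 1) := by
    have ha2 : (2 : ℝ) ≤ (2 : ℝ) ^ (m + 1) := by
      calc (2 : ℝ) = 2 ^ 1 := by norm_num
        _ ≤ 2 ^ (m + 1) := pow_le_pow_right₀ (by norm_num) (by omega)
    have h16 : (16 : ℝ) ^ (m + 1) = ((2 : ℝ) ^ (m + 1)) ^ 4 := by
      rw [← pow_mul, show (16 : ℝ) = 2 ^ 4 by norm_num, ← pow_mul]; ring_nf
    rw [h16]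
    have hcube : (2 : ℝ) ^ (m + 1) + 1 / 2 ≤ ((2 : ℝ) ^ (m + 1)) ^ 3 := by
      set a : ℝ := (2 : ℝ) ^ (m + 1) with hadef
      have ha4 : 4 ≤ a ^ 2 := by nlinarith only [ha2]
      have ha3 : 4 * a ≤ a ^ 3 := by nlinarith only [ha4, ha2]
      linarith only [ha3, ha2]
    calc (2 : ℝ) ^ (m + 1) * ((2 : ℝ) ^ (m + 1) + 1 / 2) ≤ (2 : ℝ) ^ (m + 1) * ((2 : ℝ) ^ (m + 1)) ^ 3 :=
          mul_le_mul_of_nonneg_left hcube (by positivity)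
      _ = ((2 : ℝ) ^ (m + 1)) ^ 4 := by ring
  have hLN : 2 * π * (2 : ℝ) ^ (m + 1) * ((2 : ℝ) ^ (m + 1) + 1 / 2) ≤ L := by
    have := mul_le_mul_of_nonneg_left h4pow (by positivity : (0 : ℝ) ≤ 2 * π)
    linarith only [this, hL16]
  have hL1 : (2 * B.rhomin - 4 * A) * π ≤ 2 * Real.sqrt 2 * L * klScale klE0 (m + 1) := by
    have hs1 : 1 ≤ Real.sqrt 2 := by
      rw [show (1 : ℝ) = Real.sqrt 1 by simp]; exact Real.sqrt_le_sqrt (by norm_num)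
    have h1 : π / (4 * β) * β ^ 2 ≤ klScale klE0 (m + 1) * (L : ℝ) := mul_le_mul hΛβn hLβ (by positivity) (klth_klScale_pos _).le
    have e : π / (4 * β) * β ^ 2 = π * β / 4 := by field_simp
    rw [e] at h1
    have h2 : (2 * B.rhomin - 4 * A) * π ≤ 4 * π := by nlinarith only [hγ4, hπ]
    have h3' : 4 * π ≤ 2 * 1 * (π * β / 4) := by nlinarith only [hβ128, hπ]
    calc (2 * B.rhomin - 4 * A) * π ≤ 2 * 1 * (π * β / 4) := h2.trans h3'
      _ ≤ 2 * Real.sqrt 2 * (klScale klE0 (m + 1) * (L : ℝ)) := by gcongr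
      _ = 2 * Real.sqrt 2 * L * klScale klE0 (m + 1) := by ring
  -- the far-region radius
  set q : ℕ := 2 * (2 * 2 ^ (m + 1) + 1) with hqdef
  set R₀ : ℕ := (L - 1) / q with hR₀def
  have hq0 : 0 < q := by rw [hqdef]; positivity
  have hqR : q * R₀ ≤ L - 1 := by rw [hR₀def, Nat.mul_comm]; exact Nat.div_mul_le_self (L - 1) q
  have hL1nat : 1 ≤ L := Nat.one_le_iff_ne_zero.2 (NeZero.ne L)
  have hqcast : (q : ℝ) = 2 * (2 * (2 : ℝ) ^ (m + 1) + 1) := by rw [hqdef]; push_cast; ring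
  have hR₀ : 2 * (2 * (2 : ℝ) ^ (m + 1) + 1) * (R₀ : ℝ) < L := by
    rw [← hqcast]
    have h1 : ((q * R₀ : ℕ) : ℝ) ≤ ((L - 1 : ℕ) : ℝ) := by exact_mod_cast hqR
    push_cast [Nat.cast_sub hL1nat] at h1
    linarith only [h1]
  have hR₀' : (L : ℝ) / (10 * (2 : ℝ) ^ (m + 1)) ≤ R₀ := by
    -- `q·R₀ ≥ (L − 1) − (q − 1)`, `q ≤ 5·2^{m+1}`, `L ≥ 10·2^{m+1} + 2`
    have hmod : (L - 1) % q < q := Nat.mod_lt _ hq0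
    have hdiv : q * R₀ + (L - 1) % q = L - 1 := Nat.div_add_mod (L - 1) q
    have h1 : ((L : ℝ) - 1) - q < q * R₀ := by
      have h1' : ((q * R₀ + (L - 1) % q : ℕ) : ℝ) = ((L - 1 : ℕ) : ℝ) := by exact_mod_cast hdiv
      have h2' : (((L - 1) % q : ℕ) : ℝ) < q := by exact_mod_cast hmod
      push_cast [Nat.cast_sub hL1nat] at h1'
      linarith only [h1', h2']
    have h2pow : (2 : ℝ) ≤ (2 : ℝ) ^ (m + 1) := by
      calc (2 : ℝ) = 2 ^ 1 := by norm_num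
        _ ≤ 2 ^ (m + 1) := pow_le_pow_right₀ (by norm_num) (by omega)
    have hq5 : (q : ℝ) ≤ 5 * (2 : ℝ) ^ (m + 1) := by rw [hqcast]; linarith only [h2pow]
    have h2p0 : (0 : ℝ) < (2 : ℝ) ^ (m + 1) := by positivity
    have hL10 : 10 * (2 : ℝ) ^ (m + 1) + 2 ≤ L := by
      have h8 : (8 : ℝ) ≤ (8 : ℝ) ^ (m + 1) := by
        calc (8 : ℝ) = 8 ^ 1 := by norm_num
          _ ≤ 8 ^ (m + 1) := pow_le_pow_right₀ (by norm_num) (by omega)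
      have h16 : 8 * (2 : ℝ) ^ (m + 1) ≤ (16 : ℝ) ^ (m + 1) := by
        have e : (16 : ℝ) ^ (m + 1) = (8 : ℝ) ^ (m + 1) * (2 : ℝ) ^ (m + 1) := by rw [← mul_pow]; norm_num
        rw [e]; exact mul_le_mul_of_nonneg_right h8 h2p0.le
      have h6 : 6 * (16 : ℝ) ^ (m + 1) ≤ 2 * π * (16 : ℝ) ^ (m + 1) := by nlinarith only [hπ3, pow_pos (by norm_num : (0:ℝ) < 16) (m + 1)]
      linarith only [h16, h6, hL16, h2pow]
    rw [div_le_iff₀ (by positivity)]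
    -- `2q·R₀ > 2(L − 1 − q) ≥ 2L − 2 − 10·2^{m+1} ≥ L`
    have hR0 : (0 : ℝ) ≤ R₀ := Nat.cast_nonneg _
    have h3' : (q : ℝ) * R₀ ≤ 5 * (2 : ℝ) ^ (m + 1) * R₀ := mul_le_mul_of_nonneg_right hq5 hR0
    have h3 : (q : ℝ) * R₀ * 2 ≤ (R₀ : ℝ) * (10 * (2 : ℝ) ^ (m + 1)) := by linarith only [h3']
    linarith only [h1, h3, hq5, hL10]
  have hδL : (0 : ℝ) < 1 / 2 := by norm_num
  have hΛL : (1 / 2 : ℝ) ≤ klScale klE0 (m + 1 + j) ^ 2 * L := by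
    have h1' : π / (4 * β) * β ≤ klScale klE0 (m + 1 + j) * β := mul_le_mul_of_nonneg_right hΛβs hβ0.le
    have e : π / (4 * β) * β = π / 4 := by field_simp
    have h1 : π / 4 ≤ klScale klE0 (m + 1 + j) * β := by linarith only [h1', e]
    have h2 : (π / 4) ^ 2 ≤ (klScale klE0 (m + 1 + j) * β) ^ 2 := pow_le_pow_left₀ (by positivity) h1 2
    have h3' : klScale klE0 (m + 1 + j) ^ 2 * β ^ 2 ≤ klScale klE0 (m + 1 + j) ^ 2 * (L : ℝ) :=
      mul_le_mul_of_nonneg_left hLβ (sq_nonneg (klScale klE0 (m + 1 + j)))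
    nlinarith only [h2, h3', hπ3]
  -- the closed form
  rw [hslice]
  refine ⟨fun Y => ?_, fun Y' => ?_⟩
  · have h := rowSum_sliceCT_bgmFat_closed_shift (L := L) (M := M) B hAK hADt he (by norm_num : (0 : ℝ) < 1 / 10) (by norm_num : (1 / 10 : ℝ) ≤ 1)
      hgap h3 hlo hhi hβ0 hρA m hMm hd₀ hd₀1 hd₀2 hB₀0 hB₀ hΛs hr1 hΛsr hΛΛ' hM' (by norm_num : (0 : ℝ) < 7) hK₁ hK₂ hB₁ hB₂ (by norm_num [klE0])
      hMβ hπβ hLz hLN hL1 hR₀ hR₀' hδL hΛL hcρ hG₁ hG₂ hKp hb₁ hbτ hae1 hae2 hqe hav1 hav2 hqv hDt' hx₀ hx₁ hx₂ hx₃ hc₁ hCW hCN Y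
    exact h.trans (le_of_eq (by push_cast; ring))
  · have h := colSum_sliceCT_bgmFat_closed_shift (L := L) (M := M) B hAK hADt he (by norm_num : (0 : ℝ) < 1 / 10) (by norm_num : (1 / 10 : ℝ) ≤ 1)
      hgap h3 hlo hhi hβ0 hρA m hMm hd₀ hd₀1 hd₀2 hB₀0 hB₀ hΛs hr1 hΛsr hΛΛ' hM' (by norm_num : (0 : ℝ) < 7) hK₁ hK₂ hB₁ hB₂ (by norm_num [klE0])
      hMβ hπβ hLz hLN hL1 hR₀ hR₀' hδL hΛL hcρ hG₁ hG₂ hKp hb₁ hbτ hae1 hae2 hqe hav1 hav2 hqv hDt' hx₀ hx₁ hx₂ hx₃ hc₁ hCW hCN Y'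
    exact h.trans (le_of_eq (by push_cast; ring))

/-- **`α` under EXACTLY the binders of the gen-6 engine stubs**, shift `j`: `∃ Cα > 0` with every row and column sum of
`‖S(Ft_n)ᵀ·klSliceCov (n+j)·S(Ft_n)‖` `≤ Cα·(M/β)/Λ_{n+j}` for `1 ≤ n`, `n + j ≤ nScales β + 1` (package thresholds below the absolute ones:
`klEngC₃3_le_symbolC₃`, `klEngU₀4_le_klEngU₀3`, `klEngU₀3_le_symbolU₀`; `β² ≤ L`, `β ≤ M` by `sq_le_of_klEngL₃_le`, `le_of_klEngM₃_le`).
[cite: BenfattoGiulianiMastropietro2006, §2.8 (2.81)] -/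
theorem alpha_klSliceCov_bgmFat_klEng (j : ℕ) :
    ∃ Cα : ℝ, 0 < Cα ∧ ∀ (P : SplitConsts) (R : RenConsts) (c : ℝ), P.WF → R.WF2 → 0 < c → c ≤ EngineV8.klEngC₃3 P R →
      ∀ μ ∈ klWindowC, ∀ U : ℝ, 0 < U → U ≤ EngineV8.klEngU₀4 P R c → ∀ β : ℝ, klBetaMin ≤ β → β ≤ Real.exp (c / U ^ 2) →
      ∀ K : TrigPolyC4v, FrameOK R U (nScales β) μ K → ∀ (L M : ℕ) [NeZero L] [NeZero M],
      EngineV8.klEngL₃ β U ≤ L → EngineV8.klEngM₃ β U L ≤ M → ∀ n : ℕ, 1 ≤ n → n + j ≤ nScales β + 1 →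
        (∀ Y : SpaceTimeIdx L M × SectorLeg (sectorCount n),
          ∑ Y', ‖((sectorSubMatrix L M β (bgmFatMultiplier L M klE0 β (nambuXiCT L μ K) n)).transpose * klSliceCov L M β μ K (n + j) *
            sectorSubMatrix L M β (bgmFatMultiplier L M klE0 β (nambuXiCT L μ K) n)) Y Y'‖ ≤ Cα * ((M : ℝ) / β) / klScale klE0 (n + j)) ∧
        (∀ Y' : SpaceTimeIdx L M × SectorLeg (sectorCount n),
          ∑ Y, ‖((sectorSubMatrix L M β (bgmFatMultiplier L M klE0 β (nambuXiCT L μ K) n)).transpose * klSliceCov L M β μ K (n + j) *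
            sectorSubMatrix L M β (bgmFatMultiplier L M klE0 β (nambuXiCT L μ K) n)) Y Y'‖ ≤ Cα * ((M : ℝ) / β) / klScale klE0 (n + j)) := by
  have ha : (-4 : ℝ) < -(6 / 5) := by norm_num
  have hab : (-(6 / 5) : ℝ) ≤ -(1 / 10) := by norm_num
  have hb : (-(1 / 10) : ℝ) < 0 := by norm_num
  obtain ⟨Cα, hCα, h⟩ := alpha_klSliceCov_bgmFat_of_thresholds ha hab hb j
  refine ⟨Cα, hCα, ?_⟩
  intro P R c _ hR2 hc hc3 μ hμ U hU hU0 β hβmin hβc K hK L M _ _ hL3 hM3 n hn hnN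
  have hRj : ∀ i, 0 ≤ R.Gfr i := EngineV8.gfr_nonneg_of_wf2 hR2
  exact h R hRj c U hc (hc3.trans (EngineV8.klEngC₃3_le_symbolC₃ ha hab hb P hRj)) hU
    ((hU0.trans (EngineV8.klEngU₀4_le_klEngU₀3 P R c)).trans (EngineV8.klEngU₀3_le_symbolU₀ ha hab hb P hRj c)) β hβmin hβc μ hμ K hK L M
    (EngineV8.sq_le_of_klEngL₃_le hL3) (EngineV8.le_of_klEngM₃_le hβmin hL3 hM3) n hn hnN

end Summit.HubbardSuperconductivity.HubbardSuperconductivity.Theorems.TorusFourierL2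

end
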